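import Summits.CriticalPhenomena.PercolationContinuityZ3.Theorems.Transplant.SkelPhiFaceResidue
import Summits.CriticalPhenomena.PercolationContinuityZ3.Theorems.Transplant.SkelSignClosureResidues
import HarnessLib

/-!
# N1 (the {±1} node `SamePDropOfSkeletonNeg`), interface item V1 of NEG-PARAMS (n0)/(Q3): the CORRIDOR RESIDUE and its chain accuracy with the
# maximal chain length a PARAMETER `nmax` — `Skel.ReachOblAtHN G nmax` / `Skel.ReachOblRHN G nmax` (the bodies of `Skel.ReachOblAtH` /
# `Skel.ReachOblRH` of `SkelKitResiduesHab`, p235653-lineage, with `n ≤ nmaxC := 1000` replaced by `n ≤ nmax`), the packagings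
# `Skel.reach_of_reachOblAtHN` and **`Skelφ.kitAtRun_of_oblRHN (hlip)`** (root residue `Skel.RootOblT` + φ-level face residue `Skelφ.FaceOblR` +
# `Skel.ReachOblRHN G nmax` ⟹ `KSchA.KitAtRun`, twin of hp-8 g30's `Skelφ.kitAtRun_of_oblRH`), the constant of record **`Skel.nmaxN := 2000`** of
# N1 (hp-8 g31 referee C2 on NEG-SCOPE: N1 corridors have `≤ 28·A″ + O(1) ≈ 1150 > 1000` steps at `A″ = 40` strides per unit), and the chain
# accuracy **`Skelφ.δCN G hΔ nmax ε := min_{n ≤ nmax} δUP G hΔ n ε`** with `δCN_pos/_le_one/_le_δUP/_spec` (twin of p3-g7's `Skelφ.δC`, which is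
# `δCN` at `nmax = nmaxC`) — so that the N1 closure (`SkelNeg1Closure`, p3 lineage) produces ONE chain accuracy for every corridor length
# `≤ nmaxN` and the (C) column (p5 lineage, C-COLUMN-N1-PLAN) discharges `ReachOblRHN G nmaxN`

builds on p205010 (kernel theorem, internal audit signed; external expert review pending) — nothing in this file uses p205010.
Status sentence (coordinator 2026-08-20T04:30Z): "θ(p_c) = 0 on ℤ^d, all d ≥ 2 — kernel-verified (Lean 4/Mathlib, standard axioms); internal
adversarial audit SIGNED 2026-08-20 04:29Z; external expert review pending."
Lane `prim-bschramm`, seat `prim-bschramm-p5` (gen 8; the (C) lineage and refuter of the lane); helper file (`--supports stmt-CriticalPhenomena-4575`).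
Nothing here is a claim about the open node `SamePDropOfSkeletonNeg`; these are definitions and packagings (the D″ closure of record,
`PlanarSkeletonSign.samePDropOfSkeletonSign₁_of_concSG_residuesRH`, is the `nmax = nmaxC` instance of the same text).
* §1 `Skel.nmaxN`, `Skel.ReachOblAtHN G nmax S FD Δ' δ h e a' du`, `Skel.ReachOblRHN G nmax S FD Δ' δ`, monotonicity in `nmax`, the bridges
  `reachOblAtH_iff_N` / `reachOblRH_iff_N` (`Iff.rfl`: the habitat residue of record IS the `nmaxC` instance), `Skel.reach_of_reachOblAtHN`;
* §2 `Skelφ.kitAtRun_of_oblRHN (hlip)`;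
* §3 `Skelφ.δCN G hΔ nmax ε`, `δCN_le_δUP`, `δCN_pos`, `δCN_le_one`, `δCN_spec`, `δC_eq_δCN`.
[cite: KozmaNitzan2024, §4 (30), (32) (pp. 27–28), Lemma 10 (p. 17), Lemmas 11–12 (pp. 22–25), p. 30 (Steps III–IV)]
-/

noncomputable section

open MeasureTheory ProbabilityTheory
open scoped ENNReal Classical

namespace Summit.CriticalPhenomena.PercolationContinuityZ3.Theorems.Transplant

/-! ## §1 The corridor residue with the chain-length bound a parameter -/

namespace Skel

open Literature.Probability.Percolation Literature.Probability.LatticeModels SimpleGraph KNCells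
open GadgetSystem ProbeHistory HSiteScheme Contour

variable {V : Type} [DecidableEq V] [Countable V] (G : SimpleGraph V) [G.LocallyFinite]
variable {A : Type*}

omit G in
/-- **The maximal corridor-chain length of the {±1} node N1** (`2000`): at `A″ = 40` strides per cell unit the three-phase corridor schedules of
the (C) column have `≤ 28·A″ + O(1) ≤ 1150` steps (hp-8 g31 referee C2; NEG-PARAMS (n0)/(n9)), above D″'s `nmaxC = 1000`. [this work] -/
def nmaxN : ℕ := 2000

omit G in
/-- `nmaxC ≤ nmaxN`. [folklore] -/
theorem nmaxC_le_nmaxN : nmaxC ≤ nmaxN := by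
  unfold nmaxC nmaxN; omega

/-- **The corridor obligation at one probe `(h, e, a', du)`, habitat form, chain length `≤ nmax`**: for some length `n ≤ nmax` and some finite
habitat `Ω`, a linked chain of `n + 1` target steps in `winGraphIn G Ω` with common source the scheme's root, kits at accuracy `δ` under the
corridor law `S.Wcor`, true targets inside the enlarged ones with excess `≤ η ≤ δ/2`, the arrival cube `M^{aOf₁}_{tgt e}` inside the first level
and the last true target inside `M^{a'}_{tgt e + du}` — the body of `Skel.ReachOblAtH` with `nmaxC` replaced by the parameter `nmax`.
[cite: KozmaNitzan2024, §4 Lemma 12 (pp. 23–25), p. 30 (Step IV)] -/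
def ReachOblAtHN (nmax : ℕ) (S : KSchA V A) (FD : FaceData V A) (Δ' : ℕ) (δ : ℝ) (h : ProbeHistory V) (e : Site 2 × MDir) (a' : A)
    (du : MDir) : Prop :=
  ∃ (n : ℕ) (_ : n ≤ nmax) (Ω : Finset V) (s : Fin (n + 1) → KNLevels.TStep (winGraphIn G Ω)) (T' : Fin (n + 1) → Finset V) (η : ℝ),
    (∀ i : Fin (n + 1), (s i).L.o = S.Γ.root) ∧
    (∀ i : Fin n, T' (Fin.castSucc i) ⊆ (s i.succ).L.X 0) ∧ (∀ i : Fin (n + 1), T' i ⊆ (s i).T) ∧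
    (∀ i : Fin (n + 1), (s i).KitsAt (S.Wcor G FD h e (S.aOf₁ G h e) a' du) S.p Δ' δ) ∧ η ≤ δ / 2 ∧
    (∀ i : Fin (n + 1), (prodBernoulli (S.Wcor G FD h e (S.aOf₁ G h e) a' du)).real (⋃ t ∈ (s i).T \ T' i, openConn S.Γ.root t) ≤ η) ∧
    S.Γ.M (S.aOf₁ G h e) (tgt e) ⊆ (s 0).L.X 0 ∧
    T' (Fin.last n) ⊆ S.Γ.M a' (tgt e + stepVec du)

/-- **The corridor obligations, run-restricted habitat form, chain length `≤ nmax`**: `ReachOblAtHN G nmax` for every RUN history whose chosen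
candidate is `e`, valid, and every onward direction, at `a' = aOf₂` — the node-facing (C) residue of N1 at `nmax = nmaxN`.
[cite: KozmaNitzan2024, §4 p. 30 (Step IV), Lemma 12 (pp. 23–25)] -/
def ReachOblRHN (nmax : ℕ) (S : KSchA V A) (FD : FaceData V A) (Δ' : ℕ) (δ : ℝ) : Prop :=
  ∀ h e, S.IsRun₂ G h → (S.astOf₂ G h).st.choice = some e → S.Valid₂ G h e →
    ∀ du ∈ S.onward G h (tgt e), ReachOblAtHN G nmax S FD Δ' δ h e (S.aOf₂ G h e) du

variable {G}
variable {S : KSchA V A} {FD : FaceData V A}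
variable {h : ProbeHistory V} {e : Site 2 × MDir} {a' : A} {du : MDir}

omit [Countable V] in
/-- The habitat corridor obligation of record `Skel.ReachOblAtH` IS `ReachOblAtHN G nmaxC`. [folklore] -/
theorem reachOblAtH_iff_N (Δ' : ℕ) (δ : ℝ) :
    ReachOblAtH G S FD Δ' δ h e a' du ↔ ReachOblAtHN G nmaxC S FD Δ' δ h e a' du := Iff.rfl

omit [Countable V] in
/-- The habitat corridor residue of record `Skel.ReachOblRH` IS `ReachOblRHN G nmaxC`. [folklore] -/
theorem reachOblRH_iff_N (Δ' : ℕ) (δ : ℝ) : ReachOblRH G S FD Δ' δ ↔ ReachOblRHN G nmaxC S FD Δ' δ := Iff.rfl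

omit [Countable V] in
/-- `ReachOblAtHN` is monotone in the length bound `nmax`. [folklore] -/
theorem ReachOblAtHN.mono {nmax nmax' : ℕ} (hle : nmax ≤ nmax') {Δ' : ℕ} {δ : ℝ} (hR : ReachOblAtHN G nmax S FD Δ' δ h e a' du) :
    ReachOblAtHN G nmax' S FD Δ' δ h e a' du := by
  obtain ⟨n, hn, Ω, s, T', η, hrest⟩ := hR
  exact ⟨n, hn.trans hle, Ω, s, T', η, hrest⟩

omit [Countable V] in
/-- `ReachOblRHN` is monotone in the length bound `nmax`. [folklore] -/
theorem ReachOblRHN.mono {nmax nmax' : ℕ} (hle : nmax ≤ nmax') {Δ' : ℕ} {δ : ℝ} (hR : ReachOblRHN G nmax S FD Δ' δ) :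
    ReachOblRHN G nmax' S FD Δ' δ :=
  fun h e hrun hc hV du hdu => (hR h e hrun hc hV du hdu).mono hle

/-- **`ReachOblAtHN G nmax` + the chain properties of every length `n ≤ nmax` at `(δ ↦ ε'')` in every habitat window graph + `δc ≤ δ` ⟹ the
corridor bound `1 - ε'' < P_{Wfull}(Reach)`** (`KSchA.hreach_of_chain_edge_sub`). [cite: KozmaNitzan2024, §4 Lemma 12 (pp. 23–25), p. 30 (Step IV)] -/
theorem reach_of_reachOblAtHN {nmax : ℕ} (hV : S.Valid₂ G h e) {Δ' : ℕ} {δ ε'' : ℝ} (hδc : S.δc ≤ δ)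
    (hchain : ∀ n ≤ nmax, ∀ (Ω : Finset V) (Wg : Sym2 V → unitInterval) (s : Fin (n + 1) → KNLevels.TStep (winGraphIn G Ω))
      (T' : Fin (n + 1) → Finset V) (η : ℝ),
      (∀ i : Fin (n + 1), (s i).L.o = (s 0).L.o) →
      (∀ i : Fin n, T' (Fin.castSucc i) ⊆ (s i.succ).L.X 0) →
      (∀ i : Fin (n + 1), T' i ⊆ (s i).T) →
      (∀ i : Fin (n + 1), (s i).KitsAt Wg S.p Δ' δ) →
      η ≤ δ / 2 →
      (∀ i : Fin (n + 1), (prodBernoulli Wg).real (⋃ t ∈ (s i).T \ T' i, openConn (s 0).L.o t) ≤ η) →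
      1 - δ < (prodBernoulli Wg).real (s 0).L.reachB →
        1 - ε'' < (prodBernoulli Wg).real (⋃ t ∈ T' (Fin.last n), openConn (s 0).L.o t))
    (hR : ReachOblAtHN G nmax S FD Δ' δ h e a' du) :
    1 - ε'' < (prodBernoulli (S.Wfull G h e (S.aOf₁ G h e) a' du)).real (S.Reach G FD h e (S.aOf₁ G h e) a' du) := by
  obtain ⟨n, hn, Ω, s, T', η, ho, hlink, hsub, hkits, hη, hexc, hB0, hTn⟩ := hR
  exact KSchA.hreach_of_chain_edge_sub (winGraphIn G Ω) hV hδc (hchain n hn Ω) s T' ho hlink hsub hkits hη hexc hB0 hTn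

end Skel

/-! ## §2 The run-restricted obligations from the three residues, corridor chains of length `≤ nmax` -/

namespace Skelφ

open Literature.Probability.Percolation Literature.Probability.LatticeModels SimpleGraph KNCells
open GadgetSystem ProbeHistory HSiteScheme Contour
open Skel (winGraph winGraphIn RootOblT ReachOblRHN)

variable {V : Type} [DecidableEq V] [Countable V] {G : SimpleGraph V} [G.LocallyFinite] {φ : V → Site 2}
variable {A : Type*} {S : KSchA V A} {FD : FaceData V A}

/-- **The run-restricted obligations from the named residues, habitat form, corridor chains of length `≤ nmax`** (from `Lip`): `δc ≤ δ`, the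
one-step property at `(δ₂ ↦ δc/2)` for the window graphs, the chain properties of every length `n ≤ nmax` at `(δ ↦ ε'')` for the habitat window
graphs, the chain properties of every length at `(δr n ↦ δc)` for the window graphs, `Skel.RootOblT … δr`, `Skelφ.FaceOblR … δ₂` and
`Skel.ReachOblRHN G nmax … δ` ⟹ `KSchA.KitAtRun G S FD δ₂ ε''` — twin of `Skelφ.kitAtRun_of_oblRH` (the `nmax = nmaxC` case).
[cite: KozmaNitzan2024, §4 (30), (32), Lemmas 10–12] -/
theorem kitAtRun_of_oblRHN (hlip : Lip G φ) {nmax Δ' : ℕ} {δ δ₂ ε'' : ℝ} {δr : ℕ → ℝ} (hδc : S.δc ≤ δ)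
    (hstep : ∀ (c : V) (Rπ : ℕ) (Wg : Sym2 V → unitInterval) (s : KNLevels.TStep (winGraph G c Rπ)), s.KitsAt Wg S.p Δ' δ₂ →
      1 - δ₂ < (prodBernoulli Wg).real s.L.reachB → 1 - S.δc / 2 < (prodBernoulli Wg).real (⋃ t ∈ s.T, openConn s.L.o t))
    (hchain : ∀ n ≤ nmax, ∀ (Ω : Finset V) (Wg : Sym2 V → unitInterval) (s : Fin (n + 1) → KNLevels.TStep (winGraphIn G Ω))
      (T' : Fin (n + 1) → Finset V) (η : ℝ),
      (∀ i : Fin (n + 1), (s i).L.o = (s 0).L.o) →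
      (∀ i : Fin n, T' (Fin.castSucc i) ⊆ (s i.succ).L.X 0) →
      (∀ i : Fin (n + 1), T' i ⊆ (s i).T) →
      (∀ i : Fin (n + 1), (s i).KitsAt Wg S.p Δ' δ) →
      η ≤ δ / 2 →
      (∀ i : Fin (n + 1), (prodBernoulli Wg).real (⋃ t ∈ (s i).T \ T' i, openConn (s 0).L.o t) ≤ η) →
      1 - δ < (prodBernoulli Wg).real (s 0).L.reachB →
        1 - ε'' < (prodBernoulli Wg).real (⋃ t ∈ T' (Fin.last n), openConn (s 0).L.o t))
    (hchainr : ∀ (n : ℕ) (c : V) (Rπ : ℕ) (Wg : Sym2 V → unitInterval) (s : Fin (n + 1) → KNLevels.TStep (winGraph G c Rπ))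
      (T' : Fin (n + 1) → Finset V) (η : ℝ),
      (∀ i : Fin (n + 1), (s i).L.o = (s 0).L.o) →
      (∀ i : Fin n, T' (Fin.castSucc i) ⊆ (s i.succ).L.X 0) →
      (∀ i : Fin (n + 1), T' i ⊆ (s i).T) →
      (∀ i : Fin (n + 1), (s i).KitsAt Wg S.p Δ' (δr n)) →
      η ≤ δr n / 2 →
      (∀ i : Fin (n + 1), (prodBernoulli Wg).real (⋃ t ∈ (s i).T \ T' i, openConn (s 0).L.o t) ≤ η) →
      1 - δr n < (prodBernoulli Wg).real (s 0).L.reachB →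
        1 - S.δc < (prodBernoulli Wg).real (⋃ t ∈ T' (Fin.last n), openConn (s 0).L.o t))
    (hQ0 : RootOblT G S Δ' δr) (hface : FaceOblR G φ S FD Δ' δ₂) (hreach : ReachOblRHN G nmax S FD Δ' δ) :
    KSchA.KitAtRun G S FD δ₂ ε'' := by
  refine And.intro (Skel.rootObl_of_rootOblT hchainr hQ0) (And.intro ?_ ?_)
  · intro h e hrun hc hV du hdu j hj o hsrc
    exact cond_of_faceOblAt hlip hstep (hface h e hrun hc hV du hdu j hj o) hsrc
  · intro h e hrun hc hV du hdu
    exact Skel.reach_of_reachOblAtHN hV hδc hchain (hreach h e hrun hc hV du hdu)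

/-! ## §3 One chain accuracy for every length `≤ nmax` -/

variable (G) {Δ : ℕ} (hΔ : ∀ v, G.degree v ≤ Δ)

open KNLevels in
/-- **One corridor-chain accuracy for every length `n ≤ nmax`**: `δCN nmax ε := min_{n ≤ nmax} δUP G hΔ n ε` (p3-g7's `Skelφ.δC` is the
`nmax = nmaxC` instance). [this work] -/
def δCN (nmax : ℕ) (ε : ℝ) : ℝ :=
  ((Finset.range (nmax + 1)).image fun n => δUP G hΔ n ε).min' ⟨δUP G hΔ 0 ε, Finset.mem_image.2 ⟨0, by simp, rfl⟩⟩

/-- `δCN nmax ε ≤ δUP n ε` for every `n ≤ nmax`. [folklore] -/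
theorem δCN_le_δUP (nmax : ℕ) (ε : ℝ) {n : ℕ} (hn : n ≤ nmax) : δCN G hΔ nmax ε ≤ δUP G hΔ n ε :=
  Finset.min'_le _ _ (Finset.mem_image.2 ⟨n, Finset.mem_range.2 (Nat.lt_succ_of_le hn), rfl⟩)

/-- `0 < δCN`. [folklore] -/
theorem δCN_pos (nmax : ℕ) (ε : ℝ) : 0 < δCN G hΔ nmax ε := by
  unfold δCN
  refine (Finset.lt_min'_iff _ _).2 fun y hy => ?_
  obtain ⟨n, -, rfl⟩ := Finset.mem_image.1 hy
  exact δUP_pos G hΔ n _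

/-- `δCN ≤ 1`. [folklore] -/
theorem δCN_le_one (nmax : ℕ) (ε : ℝ) : δCN G hΔ nmax ε ≤ 1 :=
  (δCN_le_δUP G hΔ nmax ε (Nat.zero_le _)).trans (δUP_le_one G hΔ 0 _)

/-- `δC = δCN nmaxC` (the D″ constant of record is the `nmaxC` instance). [folklore] -/
theorem δC_eq_δCN (ε : ℝ) : δC G hΔ ε = δCN G hΔ Skel.nmaxC ε := rfl

open KNLevels in
/-- **The chain property of every length `n ≤ nmax` at the accuracy `δCN nmax ε`**, in every subgraph `G' ≤ G`, for every `q < 1`, delivering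
`1 − ε`. [cite: KozmaNitzan2024, §4 Lemma 12 (pp. 23–25)] -/
theorem δCN_spec {nmax : ℕ} {ε : ℝ} (hε : 0 < ε) {n : ℕ} (hn : n ≤ nmax) {q : unitInterval} (hq1 : (q : ℝ) < 1)
    (G' : SimpleGraph V) [G'.LocallyFinite] (hG' : G' ≤ G) :
    ∀ (Wt : Sym2 V → unitInterval) (s : Fin (n + 1) → TStep G') (T' : Fin (n + 1) → Finset V) (η : ℝ),
      (∀ i : Fin (n + 1), (s i).L.o = (s 0).L.o) →
      (∀ i : Fin n, T' (Fin.castSucc i) ⊆ (s i.succ).L.X 0) →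
      (∀ i : Fin (n + 1), T' i ⊆ (s i).T) →
      (∀ i : Fin (n + 1), (s i).KitsAt Wt q Δ (δCN G hΔ nmax ε)) →
      η ≤ δCN G hΔ nmax ε / 2 →
      (∀ i : Fin (n + 1), (prodBernoulli Wt).real (⋃ t ∈ (s i).T \ T' i, openConn (s 0).L.o t) ≤ η) →
      1 - δCN G hΔ nmax ε < (prodBernoulli Wt).real (s 0).L.reachB →
        1 - ε < (prodBernoulli Wt).real (⋃ t ∈ T' (Fin.last n), openConn (s 0).L.o t) := by
  intro Wt s T' η ho hlink hsub hkits hη hexc hsrc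
  have hle := δCN_le_δUP G hΔ nmax ε hn
  exact δUP_spec G hΔ n hε q hq1 G' hG' Wt s T' η ho hlink hsub (fun i => (hkits i).mono hle) (hη.trans (by linarith)) hexc
    (by linarith)

end Skelφ

end Summit.CriticalPhenomena.PercolationContinuityZ3.Theorems.Transplant

end
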